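import Summits.QuantumFields.GaugeBoot.FrameTwoDimAnnulus
import HarnessLib

/-!
# Two-dimensional site frames: the split of the Boltzmann weight of the link mirror (gauge-boot, L3 positive supplement; link reflection in two dimensions at every `β`, part 2)

HONEST FRAMING (cell `pub-gaugeboot`, page 1 of every file): the venture produces certified bounds
on lattice expectations at stated coupling, gauge group, dimension and torus size; NOT a mass gap,
NOT a continuum limit, NOT a string tension; NOT Yang–Mills-summit-bearing (barriers
`FixedCouplingUltralocality`, `PerturbativeInvisibility`). Measure-theoretic bookkeeping for a
POSITIVE structural result (`FrameTwoDimLinkRP.lean`); it bounds no expectation of the venture's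
tables.

Setting of `FrameTwoDimAnnulus.lean`: a site frame `IsSiteFrame e k σ Q h` with its mid-plane (link)
reflection `Θ = configMidReflect e k σ`, and — for the split — a two-dimensional site frame
`IsTwoDimFrame e k l σ Q h m`. Contents:

* for ANY site frame: the half-weighted observable `g = F · e^{β A}` (`midGObs` of
  `TiltedLinkRPPositivity.lean`, `A` the positive part of the plaquette sum) is bounded for EVERY real
  `β` (`norm_midGObs_le_abs`; the lane's `norm_midGObs_le` carried `0 ≤ β`) and depends only on the
  positive links (`midGObs_congr_pos`); the integrand after the split `H = g · conj(g ∘ Θ)` (`midH`),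
  measurable and bounded;
* for a two-dimensional site frame: `H` is blind to the rungs of both annuli (`midH_update_rung`), and
  **`boltzmann_split`**: `e^{-β S(U)} conj F(ΘU) F(U) = e^{-β N #plaquettes} · H(U) · ∏_{upper annulus}
  plaqWt · ∏_{lower annulus} plaqWt` — the Osterwalder–Seiler splitting `∑_p Re tr ρ(U_p) = A(U) +
  A(ΘU) + X(U)` (`IsSiteFrame.sum_plaqObs_split_mid`) with the crossing part `X` read as the two
  closed annuli of `FrameTwoDimAnnulus.lean`. No sign condition on `β` anywhere.

Everything is `[folklore]` bookkeeping (Osterwalder–Seiler 1978 §2; Migdal 1975).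

References: K. Osterwalder, E. Seiler, Ann. Phys. 110 (1978) 440, §2; A. A. Migdal, Sov. Phys. JETP
42 (1975) 413; J. Fröhlich, R. Israel, E. H. Lieb, B. Simon, J. Stat. Phys. 22 (1980) 297, §3.
-/

noncomputable section

open MeasureTheory Complex Function
open scoped ComplexConjugate
open Literature.RepresentationTheory.CompactGroups

namespace Summit.QuantumFields.GaugeBoot

namespace TiltedRP

variable {A : Type*} [AddCommGroup A] [Fintype A] {d : ℕ}

/-! ## The half-weighted observable at every real `β`, the integrand `H` -/

namespace IsSiteFrame

variable {e : Fin d → A} {k : Fin d} {σ : A →+ A} {Q : ℕ} {h : A →+ ZMod (2 * Q)}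
variable (hF : IsSiteFrame e k σ Q h)
variable {N : ℕ} {G : Type*} [Group G] [TopologicalSpace G] [IsTopologicalGroup G] [CompactSpace G]
  [MeasurableSpace G] [BorelSpace G] [SecondCountableTopology G]
variable (ρ : G →* Matrix (Fin N) (Fin N) ℂ)
include hF

open scoped Classical in
omit [MeasurableSpace G] [BorelSpace G] [SecondCountableTopology G] hF in
/-- **`g = F e^{β A}` is bounded at EVERY real `β`**: `‖g‖ ≤ |C_F| e^{|β| N #plaquettes}`. [folklore] -/
theorem norm_midGObs_le_abs (hρ : Continuous ρ) (β : ℝ) {F : Config A d G → ℂ} {CF : ℝ}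
    (hFb : ∀ U, ‖F U‖ ≤ CF) (V : Config A d G) :
    ‖midGObs ρ e k Q h β F V‖ ≤ |CF| * Real.exp (|β| * (N * Fintype.card (Plaq A d))) := by
  rw [midGObs, norm_mul, Complex.norm_real, Real.norm_eq_abs, abs_of_pos (Real.exp_pos _)]
  refine mul_le_mul ((hFb V).trans (le_abs_self _)) (Real.exp_le_exp.2 ?_) (Real.exp_pos _).le
    (abs_nonneg _)
  have h1 := abs_sum_plaqObs_le ρ hρ e (Finset.univ.filter (IsMidPosPlaq k Q h)) V
  have c1 : ((Finset.univ.filter (IsMidPosPlaq k Q h)).card : ℝ) ≤ Fintype.card (Plaq A d) := by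
    exact_mod_cast Finset.card_filter_le _ _
  have hN : (0 : ℝ) ≤ N := Nat.cast_nonneg _
  calc β * ∑ p ∈ Finset.univ.filter (IsMidPosPlaq k Q h), plaqObs ρ e p V
      ≤ |β * ∑ p ∈ Finset.univ.filter (IsMidPosPlaq k Q h), plaqObs ρ e p V| := le_abs_self _
    _ = |β| * |∑ p ∈ Finset.univ.filter (IsMidPosPlaq k Q h), plaqObs ρ e p V| := abs_mul _ _
    _ ≤ |β| * (N * (Finset.univ.filter (IsMidPosPlaq k Q h)).card) :=
        mul_le_mul_of_nonneg_left h1 (abs_nonneg β)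
    _ ≤ |β| * (N * Fintype.card (Plaq A d)) :=
        mul_le_mul_of_nonneg_left (mul_le_mul_of_nonneg_left c1 hN) (abs_nonneg β)

omit [TopologicalSpace G] [IsTopologicalGroup G] [CompactSpace G] [MeasurableSpace G] [BorelSpace G]
  [SecondCountableTopology G] in
/-- `g` depends only on the positive links (agreement on positive links suffices). [folklore] -/
theorem midGObs_congr_pos (β : ℝ) {F : Config A d G → ℂ} (hFo : IsMidObservable e Q h F)
    {U V : Config A d G} (hUV : ∀ l, IsMidPosLink e Q h l → U l = V l) :
    midGObs ρ e k Q h β F U = midGObs ρ e k Q h β F V := by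
  simp only [midGObs, hFo U V hUV, hF.sum_pos_congr ρ hUV]

omit hF in
/-- **The integrand after the split**: `H = g · conj(g ∘ Θ)`, `g = F e^{β A}`. -/
def midH (e : Fin d → A) (k : Fin d) (σ : A →+ A) (Q : ℕ) (h : A →+ ZMod (2 * Q)) (β : ℝ)
    (F : Config A d G → ℂ) (U : Config A d G) : ℂ :=
  midGObs ρ e k Q h β F U * conj (midGObs ρ e k Q h β F (configMidReflect e k σ U))

omit [CompactSpace G] hF in
/-- `H` is measurable. [folklore] -/
theorem measurable_midH (hρ : Continuous ρ) (β : ℝ) {F : Config A d G → ℂ} (hFm : Measurable F) :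
    Measurable (midH ρ e k σ Q h β F) :=
  (measurable_midGObs ρ hρ β hFm).mul (Complex.continuous_conj.measurable.comp
    ((measurable_midGObs ρ hρ β hFm).comp (measurable_configMidReflect (e := e) (k := k) (σ := σ))))

omit [MeasurableSpace G] [BorelSpace G] [SecondCountableTopology G] hF in
/-- `H` is bounded at every real `β`. [folklore] -/
theorem norm_midH_le (hρ : Continuous ρ) (β : ℝ) {F : Config A d G → ℂ} {CF : ℝ}
    (hFb : ∀ U, ‖F U‖ ≤ CF) (U : Config A d G) :
    ‖midH ρ e k σ Q h β F U‖ ≤ (|CF| * Real.exp (|β| * (N * Fintype.card (Plaq A d)))) *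
      (|CF| * Real.exp (|β| * (N * Fintype.card (Plaq A d)))) := by
  have h1 := norm_midGObs_le_abs (e := e) (k := k) (Q := Q) (h := h) ρ hρ β hFb U
  have h2 := norm_midGObs_le_abs (e := e) (k := k) (Q := Q) (h := h) ρ hρ β hFb (configMidReflect e k σ U)
  rw [midH, norm_mul, Complex.norm_conj]
  exact mul_le_mul h1 h2 (norm_nonneg _) ((norm_nonneg _).trans h1)

end IsSiteFrame

/-! ## Two dimensions: `H` is blind to the rungs; the split of the Boltzmann weight -/

namespace IsTwoDimFrame

open TwoDimFrame

variable {e : Fin d → A} {k l : Fin d} {σ : A →+ A} {Q : ℕ} {h : A →+ ZMod (2 * Q)} {m : ℕ}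
variable (hT : IsTwoDimFrame e k l σ Q h m)
variable {N : ℕ} {G : Type*} [Group G] [TopologicalSpace G] [IsTopologicalGroup G] [CompactSpace G]
variable (ρ : G →* Matrix (Fin N) (Fin N) ℂ)
include hT

omit [TopologicalSpace G] [IsTopologicalGroup G] [CompactSpace G] in
/-- **`H` does not see the rungs of the two annuli.** [folklore] -/
theorem midH_update_rung [DecidableEq A] (β : ℝ) {F : Config A d G → ℂ}
    (hFo : IsMidObservable e Q h F) {c : ℕ} (hc : c = 0 ∨ c = Q) (s : ℕ) (U : Config A d G) (z : G) :
    IsSiteFrame.midH ρ e k σ Q h β F (update U (rung₂ e k l c s) z) =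
      IsSiteFrame.midH ρ e k σ Q h β F U := by
  unfold IsSiteFrame.midH
  rw [hT.toIsSiteFrame.midGObs_congr_pos ρ β hFo (fun l' hl' => hT.apply_update_rung hc s U z hl'),
    hT.toIsSiteFrame.midGObs_congr_pos ρ β hFo
      (U := configMidReflect e k σ (update U (rung₂ e k l c s) z)) (V := configMidReflect e k σ U)
      (fun l' hl' => hT.configMidReflect_update_rung hc s U z hl')]

open scoped Classical in
/-- The exponent: `-β S(U) = -β N #P + β A(U) + β A(ΘU) + β ∑_{upper} + β ∑_{lower}`. [folklore] -/
theorem neg_mul_wilsonAction_eq (hρ : Continuous ρ) (β : ℝ) (U : Config A d G) :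
    -β * wilsonAction ρ e U =
      -β * (N * Fintype.card (Plaq A d)) +
        β * ∑ p ∈ Finset.univ.filter (IsMidPosPlaq k Q h), plaqObs ρ e p U +
        β * ∑ p ∈ Finset.univ.filter (IsMidPosPlaq k Q h), plaqObs ρ e p (configMidReflect e k σ U) +
        β * ∑ p ∈ Finset.univ.filter (IsUpperPlaq k Q h), plaqObs ρ e p U +
        β * ∑ p ∈ Finset.univ.filter (IsLowerPlaq k Q h), plaqObs ρ e p U := by
  rw [wilsonAction_eq, hT.toIsSiteFrame.sum_plaqObs_split_mid ρ hρ U,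
    hT.toIsSiteFrame.sum_cross_eq_sum_lower_add_sum_upper (fun p => plaqObs ρ e p U)]
  ring

open scoped Classical in
/-- **The split of the Boltzmann weight of the link mirror in two dimensions**:
`e^{-β S(U)} conj F(ΘU) F(U) = e^{-β N #P} · H(U) · ∏_{t<2m} plaqWt_t(upper) · ∏_{t<2m} plaqWt_t(lower)`.
[folklore] -/
theorem boltzmann_split (hρ : Continuous ρ) (β : ℝ) (F : Config A d G → ℂ) (U : Config A d G) :
    (Real.exp (-β * wilsonAction ρ e U) : ℂ) * (conj (F (configMidReflect e k σ U)) * F U) =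
      (Real.exp (-β * (N * Fintype.card (Plaq A d))) : ℂ) *
        (IsSiteFrame.midH ρ e k σ Q h β F U *
          (∏ t ∈ Finset.range (2 * m),
            SlabKernel.plaqWt (SlabKernel.wilsonWt ρ β) (rung₂ e k l Q) (lo₂ e k l Q) (up₂ e k l Q) t U) *
          ∏ t ∈ Finset.range (2 * m),
            SlabKernel.plaqWt (SlabKernel.wilsonWt ρ β) (rung₂ e k l 0) (lo₂ e k l 0) (up₂ e k l 0) t U) := by
  have hlo : Real.exp (β * ∑ p ∈ Finset.univ.filter (IsLowerPlaq k Q h), plaqObs ρ e p U) =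
      ∏ p ∈ Finset.univ.filter (IsLowerPlaq k Q h), Real.exp (β * plaqObs ρ e p U) := by
    rw [Finset.mul_sum, Real.exp_sum]
  have hup : Real.exp (β * ∑ p ∈ Finset.univ.filter (IsUpperPlaq k Q h), plaqObs ρ e p U) =
      ∏ p ∈ Finset.univ.filter (IsUpperPlaq k Q h), Real.exp (β * plaqObs ρ e p U) := by
    rw [Finset.mul_sum, Real.exp_sum]
  rw [hT.neg_mul_wilsonAction_eq ρ hρ β U, Real.exp_add, Real.exp_add, Real.exp_add, Real.exp_add,
    hlo, hup]
  simp only [Complex.ofReal_mul, Complex.ofReal_prod]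
  rw [hT.prod_exp_lower_eq_prod_plaqWt ρ hρ β U, hT.prod_exp_upper_eq_prod_plaqWt ρ hρ β U,
    IsSiteFrame.midH, IsSiteFrame.midGObs, IsSiteFrame.midGObs, map_mul, Complex.conj_ofReal]
  ring

end IsTwoDimFrame

end TiltedRP

end Summit.QuantumFields.GaugeBoot

end
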